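import Literature.Geometry.MetricGeometry.Ultralimit
import Literature.Geometry.MetricGeometry.PointedGromovHausdorff
import HarnessLib

/-!
# Gromov's precompactness theorem, pointed form

Huang–Huang–Wang–Zhu 2026, Thm 2.1 (arXiv:2605.24380, §2.1 p. 6, quoting Fukaya–Yamaguchi and
Gromov), first assertion, is used in §4 (p. 13) for the NONCOMPACT pointed covers `(M̂ᵢ, p̂ᵢ)`:
"passing to a subsequence if necessary, `(Xᵢ, pᵢ, Gᵢ) → (X, p, G)`". The underlying existence
statement is Gromov's precompactness theorem in pointed form: if the balls `B̄(pᵢ, R)` of a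
sequence of pointed (pseudo)metric spaces admit, for every `R` and `ε > 0`, `ε`-dense finite
subsets of cardinality bounded independently of `i` (for Riemannian manifolds with `Ric ≥ -(n-1)δ`
this is Bishop–Gromov volume comparison — not treated here), then a subsequence converges in the
pointed Gromov–Hausdorff sense to a PROPER metric space. The tree has the compact version
(`GromovHausdorffApprox.lean` §3, via Mathlib's `GromovHausdorff.totallyBounded`) and the pointed
vocabulary (`PointedGromovHausdorff.lean`: `IsPointedGHApprox`, `PointedGHConv`); this file proves
the pointed theorem with the ultralimit of `Ultralimit.lean` as the limit:

* `exists_net_fun` — bookkeeping: an `ε`-covering of `B̄(pᵢ, R)` by `≤ N` points yields a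
  `2ε`-net INSIDE the ball, enumerated by `ℕ` with the base point at index `0`;
* `Ultrafilter.exists_le_eventually_of_eventually_exists_le` — finite disjunctions commute with
  `U`-almost everywhere;
* `eventually_exists_isPointedGHApprox` — **for every `R`, `ε > 0`, `U`-almost every `(Xᵢ, pᵢ)`
  admits a pointed `(R, ε)`-approximation to the ultralimit** (transport a net, compare the finitely
  many net distances with their `U`-limits);
* `isCompact_closedBall_ultralimit`, `properSpace_ultralimit` — **the ultralimit is proper**
  (complete by `Ultralimit.lean`, balls totally bounded by the limiting nets);
* `exists_strictMono_pointedGHConv` — **the theorem**: a subsequence `(X_{φ n}, p_{φ n})`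
  converges to `(lim_U Xᵢ, basePt)` in the sense of `PointedGHConv`.

Everything is proved; no new definitions besides the net bookkeeping, no named facts.

## References

* M. Gromov, *Groups of polynomial growth and expanding maps*, Publ. IHÉS 53 (1981) 53–78, §6
  (precompactness). (Context.)
* K. Fukaya, T. Yamaguchi, Ann. of Math. 136 (1992) 253–333, §3. (Context.)
* H. Huang, X.-T. Huang, J. Wang, X. Zhu, arXiv:2605.24380 (2026), §2.1 p. 6, Thm 2.1 (first
  assertion); §4 p. 13. [HuangHuangWangZhu2026]
-/

noncomputable section

open Set Filter Metric Topology

namespace Literature.Geometry.MetricGeometry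

/-! ### §1. Nets inside balls, enumerated -/

section Net

variable {Z : Type*} [PseudoMetricSpace Z]

/-- **An `ε`-covering by `≤ N` points yields an enumerated `2ε`-net inside the ball**: given a
finite `S`, `#S ≤ N`, with every point of `B̄(p, R)` within `ε` of `S`, there is `e : ℕ → Z` with
`e 0 = p`, all `e k ∈ B̄(p, R)`, and every point of `B̄(p, R)` within `2ε` of some `e k`, `k ≤ N`
(replace each useful `s ∈ S` by a point of the ball within `ε` of it). [folklore] -/
theorem exists_net_fun {p : Z} {R ε : ℝ} (hR : 0 ≤ R) {N : ℕ} {S : Finset Z} (hS : S.card ≤ N)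
    (hcov : ∀ x ∈ closedBall p R, ∃ s ∈ S, dist x s ≤ ε) :
    ∃ e : ℕ → Z, e 0 = p ∧ (∀ k, dist (e k) p ≤ R) ∧
      ∀ x ∈ closedBall p R, ∃ k, k ≤ N ∧ dist x (e k) ≤ 2 * ε := by
  classical
  -- a point of the ball near each useful net point
  set c : Z → Z := fun s ↦
    if h : ∃ x ∈ closedBall p R, dist x s ≤ ε then h.choose else p with hc
  have hcR : ∀ s, dist (c s) p ≤ R := fun s ↦ by
    simp only [hc]
    split_ifs with h
    · exact mem_closedBall.1 h.choose_spec.1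
    · rw [dist_self]; exact hR
  have hcs : ∀ s, (∃ x ∈ closedBall p R, dist x s ≤ ε) → dist (c s) s ≤ ε := fun s h ↦ by
    simp only [hc, dif_pos h]
    exact h.choose_spec.2
  -- enumeration through `S ≃ Fin #S`
  set e : ℕ → Z := fun k ↦
    if k = 0 then p else
      if h : k - 1 < S.card then c (S.equivFin.symm ⟨k - 1, h⟩ : S) else p with he
  refine ⟨e, by simp [he], fun k ↦ ?_, fun x hx ↦ ?_⟩
  · simp only [he]
    split_ifs
    · rw [dist_self]; exact hR
    · exact hcR _
    · rw [dist_self]; exact hR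
  · obtain ⟨s, hs, hxs⟩ := hcov x hx
    set j : Fin S.card := S.equivFin ⟨s, hs⟩ with hj
    refine ⟨j.val + 1, by omega, ?_⟩
    have hej : e (j.val + 1) = c s := by
      simp only [he, Nat.add_one_ne_zero, if_false, Nat.add_sub_cancel, j.isLt, dif_pos]
      rw [hj, Equiv.symm_apply_apply]
    rw [hej]
    calc dist x (c s) ≤ dist x s + dist s (c s) := dist_triangle _ _ _
      _ ≤ ε + ε := add_le_add hxs (by rw [dist_comm]; exact hcs s ⟨x, hx, hxs⟩)
      _ = 2 * ε := by ring

end Net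

/-! ### §2. Finite disjunctions `U`-almost everywhere -/

/-- Along an ultrafilter, "`U`-almost everywhere some `k ≤ N` works" implies "some `k ≤ N` works
`U`-almost everywhere". [folklore] -/
theorem _root_.Ultrafilter.exists_le_eventually_of_eventually_exists_le (U : Ultrafilter ℕ) {N : ℕ}
    {P : ℕ → ℕ → Prop} (h : ∀ᶠ j in (U : Filter ℕ), ∃ k, k ≤ N ∧ P k j) :
    ∃ k, k ≤ N ∧ ∀ᶠ j in (U : Filter ℕ), P k j := by
  by_contra hcon
  simp only [not_exists, not_and] at hcon
  have hall : ∀ k ∈ Finset.range (N + 1), ∀ᶠ j in (U : Filter ℕ), ¬ P k j := fun k hk ↦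
    Ultrafilter.eventually_not.2 (hcon k (Nat.lt_succ_iff.1 (Finset.mem_range.1 hk)))
  rw [← Filter.eventually_all_finset] at hall
  obtain ⟨j, ⟨k, hkN, hPk⟩, hj⟩ := (h.and hall).exists
  exact hj k (Finset.mem_range.2 (Nat.lt_succ_iff.2 hkN)) hPk

/-- A `U`-large set is frequent along `atTop` when `U` is finer than `atTop`. [folklore] -/
theorem frequently_atTop_of_eventually_ultrafilter {U : Ultrafilter ℕ} (hU : (U : Filter ℕ) ≤ atTop)
    {S : ℕ → Prop} (h : ∀ᶠ i in (U : Filter ℕ), S i) : ∃ᶠ i in atTop, S i := by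
  intro hc
  obtain ⟨i, hi, hni⟩ := (h.and (hU hc)).exists
  exact hni hi

/-! ### §3. Approximations of the ultralimit and properness -/

section Limit

variable {X : ℕ → Type*} [∀ i, PseudoMetricSpace (X i)] {p : ∀ i, X i} {U : Ultrafilter ℕ}

/-- **Uniformly totally bounded pointed spaces approximate their ultralimit**: if for all `R` and
`ε > 0` the balls `B̄(pᵢ, R)` are covered by `ε`-balls around at most `N(R, ε)` points, then for all
`R ≥ 0`, `ε > 0`, for `U`-almost every `i` there is a pointed `(R, ε)`-Gromov–Hausdorff approximation
`(Xᵢ, pᵢ) → (lim_U Xⱼ, basePt)`: choose `2ε₀`-nets `eᵢ(k)`, `k ≤ N`, inside the balls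
(`ε = 5ε₀`), let `c k` be the class of the sequence `(eᵢ(k))ᵢ`, and send `x` to `c k(x)` for a net
point `eᵢ(k(x))` within `2ε₀` of `x`; for the `U`-almost all `i` at which the finitely many net
distances `d(eᵢ k, eᵢ l)` are within `ε₀` of their `U`-limits `d(c k, c l)` this has distortion
`≤ 5ε₀`, and every point of `B̄(basePt, R - 2ε)` is within `2ε₀` of some `c k`.
[cite: HuangHuangWangZhu2026, §2.1 p. 6 Thm 2.1 (first assertion)] -/
theorem eventually_exists_isPointedGHApprox
    (hcov : ∀ (R ε : ℝ), 0 < ε → ∃ N : ℕ, ∀ i, ∃ S : Finset (X i), S.card ≤ N ∧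
      ∀ x ∈ closedBall (p i) R, ∃ s ∈ S, dist x s ≤ ε)
    {R : ℝ} (hR : 0 ≤ R) {ε : ℝ} (hε : 0 < ε) :
    ∀ᶠ i in (U : Filter ℕ), ∃ f : X i → Ultralimit p U,
      IsPointedGHApprox R ε (p i) (Ultralimit.basePt p U) f := by
  classical
  set ε₀ : ℝ := ε / 5 with hε₀
  have hε₀0 : 0 < ε₀ := by positivity
  -- nets inside the balls
  obtain ⟨N, hN⟩ := hcov R ε₀ hε₀0
  choose S hScard hScov using hN
  choose e he0 heR hecov using fun i ↦ exists_net_fun hR (hScard i) (hScov i)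
  -- the limiting net points
  set net : ℕ → PreUltralimit p U := fun k ↦ ⟨fun i ↦ e i k, R, fun i ↦ heR i k⟩ with hnet
  set c : ℕ → Ultralimit p U := fun k ↦ Ultralimit.mk (net k) with hc
  have hc0 : c 0 = Ultralimit.basePt p U := by
    refine eq_of_dist_eq_zero ?_
    simp only [hc, Ultralimit.dist_mk_basePt, hnet, he0, dist_self]
    exact ulimReal_const 0
  have hcdist : ∀ k l, dist (c k) (c l) = dist (net k) (net l) := fun k l ↦ Ultralimit.dist_mk _ _
  -- the good indices: net distances `ε₀`-close to their limits
  have hgood : ∀ᶠ i in (U : Filter ℕ), ∀ k ∈ Finset.range (N + 1), ∀ l ∈ Finset.range (N + 1),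
      |dist (e i k) (e i l) - dist (c k) (c l)| < ε₀ := by
    rw [Filter.eventually_all_finset]
    intro k _
    rw [Filter.eventually_all_finset]
    intro l _
    refine ((net k).eventually_abs_dist_sub_lt (net l) hε₀0).mono fun i hi ↦ ?_
    rw [hcdist]
    exact hi
  refine hgood.mono fun i hi ↦ ?_
  have hi' : ∀ k, k ≤ N → ∀ l, l ≤ N → |dist (e i k) (e i l) - dist (c k) (c l)| < ε₀ :=
    fun k hk l hl ↦ hi k (Finset.mem_range.2 (Nat.lt_succ_iff.2 hk)) l
      (Finset.mem_range.2 (Nat.lt_succ_iff.2 hl))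
  -- the index of a net point near `x`
  set kf : X i → ℕ := fun x ↦
    if x = p i then 0 else
      if h : ∃ k, k ≤ N ∧ dist x (e i k) ≤ 2 * ε₀ then h.choose else 0 with hkf
  have hkfP : ∀ x ∈ closedBall (p i) R, kf x ≤ N ∧ dist x (e i (kf x)) ≤ 2 * ε₀ := by
    intro x hx
    simp only [hkf]
    split_ifs with hxp h
    · subst hxp
      rw [he0, dist_self]
      exact ⟨Nat.zero_le _, by positivity⟩
    · exact h.choose_spec
    · exact (h (hecov i x hx)).elim
  have hkf0 : kf (p i) = 0 := by simp [hkf]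
  refine ⟨fun x ↦ c (kf x), ?_, ?_, ?_⟩
  · -- base points
    show c (kf (p i)) = _
    rw [hkf0, hc0]
  · -- distortion
    intro x₁ h₁ x₂ h₂
    obtain ⟨hk₁, hd₁⟩ := hkfP x₁ h₁
    obtain ⟨hk₂, hd₂⟩ := hkfP x₂ h₂
    have hA := hi' _ hk₁ _ hk₂
    have hB : |dist (e i (kf x₁)) (e i (kf x₂)) - dist x₁ x₂| ≤ 4 * ε₀ := by
      have h1 := abs_dist_sub_le (e i (kf x₁)) x₁ (e i (kf x₂))
      have h2 := abs_dist_sub_le (e i (kf x₂)) x₂ x₁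
      rw [dist_comm (e i (kf x₂)) x₁, dist_comm x₂ x₁] at h2
      rw [dist_comm x₁ (e i (kf x₁))] at hd₁
      rw [dist_comm x₂ (e i (kf x₂))] at hd₂
      have := abs_sub_le (dist (e i (kf x₁)) (e i (kf x₂))) (dist x₁ (e i (kf x₂))) (dist x₁ x₂)
      linarith
    show |dist (c (kf x₁)) (c (kf x₂)) - dist x₁ x₂| ≤ ε
    have := abs_sub_le (dist (c (kf x₁)) (c (kf x₂))) (dist (e i (kf x₁)) (e i (kf x₂))) (dist x₁ x₂)
    rw [abs_sub_comm] at hA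
    have h5 : ε = 5 * ε₀ := by simp only [hε₀]; ring
    linarith
  · -- density
    intro y hy
    obtain ⟨yy, rfl⟩ := Ultralimit.mk_surjective y
    rw [mem_closedBall, Ultralimit.basePt, Ultralimit.dist_mk] at hy
    -- `U`-almost everywhere the representative lies in the ball and is covered by the net
    have hyR : ∀ᶠ j in (U : Filter ℕ), dist (yy.seq j) (p j) < R := by
      have hlt : dist yy (PreUltralimit.base p U) < R := by
        have : 0 < ε := hε
        linarith
      simpa using PreUltralimit.eventually_dist_lt hlt
    have hycov : ∀ᶠ j in (U : Filter ℕ), ∃ k, k ≤ N ∧ dist (yy.seq j) (e j k) ≤ 2 * ε₀ :=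
      hyR.mono fun j hj ↦ hecov j _ (mem_closedBall.2 hj.le)
    obtain ⟨k, hkN, hk⟩ := U.exists_le_eventually_of_eventually_exists_le hycov
    have hyk : dist (Ultralimit.mk yy) (c k) ≤ 2 * ε₀ := by
      rw [hc, Ultralimit.dist_mk]
      exact PreUltralimit.dist_le_of_eventually_le hk
    -- the net point upstairs
    refine ⟨e i k, mem_closedBall.2 (heR i k), ?_⟩
    obtain ⟨hk', hd'⟩ := hkfP (e i k) (mem_closedBall.2 (heR i k))
    have hA := hi' _ hk' _ hkN
    show dist (c (kf (e i k))) (Ultralimit.mk yy) ≤ ε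
    have h5 : ε = 5 * ε₀ := by simp only [hε₀]; ring
    calc dist (c (kf (e i k))) (Ultralimit.mk yy)
        ≤ dist (c (kf (e i k))) (c k) + dist (c k) (Ultralimit.mk yy) := dist_triangle _ _ _
      _ ≤ (dist (e i (kf (e i k))) (e i k) + ε₀) + 2 * ε₀ := by
          gcongr
          · have := (abs_lt.1 hA).1
            linarith
          · rwa [dist_comm]
      _ ≤ (2 * ε₀ + ε₀) + 2 * ε₀ := by
          gcongr
          rwa [dist_comm]
      _ = ε := by rw [h5]; ring

/-- **The ultralimit of uniformly totally bounded pointed spaces has compact closed balls** about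
the base point: complete (`Ultralimit.completeSpace`) and totally bounded (for `δ > 0`, the
classes of the net sequences at scale `δ/3` for radius `R + 1` are `δ`-dense in `B̄(basePt, R)`).
[cite: HuangHuangWangZhu2026, §2.1 p. 6 Thm 2.1 (first assertion)] -/
theorem isCompact_closedBall_ultralimit (hU : (U : Filter ℕ) ≤ atTop)
    (hcov : ∀ (R ε : ℝ), 0 < ε → ∃ N : ℕ, ∀ i, ∃ S : Finset (X i), S.card ≤ N ∧
      ∀ x ∈ closedBall (p i) R, ∃ s ∈ S, dist x s ≤ ε)
    {R : ℝ} (hR : 0 ≤ R) : IsCompact (closedBall (Ultralimit.basePt p U) R) := by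
  haveI := Ultralimit.completeSpace (p := p) hU
  rw [isCompact_iff_totallyBounded_isComplete]
  refine ⟨Metric.totallyBounded_iff.2 fun δ hδ ↦ ?_, isClosed_closedBall.isComplete⟩
  set ε₀ : ℝ := δ / 3 with hε₀
  have hε₀0 : 0 < ε₀ := by positivity
  obtain ⟨N, hN⟩ := hcov (R + 1) ε₀ hε₀0
  choose S hScard hScov using hN
  choose e he0 heR hecov using fun i ↦ exists_net_fun (by linarith) (hScard i) (hScov i)
  set net : ℕ → PreUltralimit p U := fun k ↦ ⟨fun i ↦ e i k, R + 1, fun i ↦ heR i k⟩ with hnet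
  set c : ℕ → Ultralimit p U := fun k ↦ Ultralimit.mk (net k) with hc
  refine ⟨c '' (Finset.range (N + 1) : Set ℕ), (Finset.finite_toSet _).image c, fun y hy ↦ ?_⟩
  obtain ⟨yy, rfl⟩ := Ultralimit.mk_surjective y
  rw [mem_closedBall, Ultralimit.basePt, Ultralimit.dist_mk] at hy
  have hyR : ∀ᶠ j in (U : Filter ℕ), dist (yy.seq j) (p j) < R + 1 := by
    have hlt : dist yy (PreUltralimit.base p U) < R + 1 := by linarith
    simpa using PreUltralimit.eventually_dist_lt hlt
  have hycov : ∀ᶠ j in (U : Filter ℕ), ∃ k, k ≤ N ∧ dist (yy.seq j) (e j k) ≤ 2 * ε₀ :=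
    hyR.mono fun j hj ↦ hecov j _ (mem_closedBall.2 hj.le)
  obtain ⟨k, hkN, hk⟩ := U.exists_le_eventually_of_eventually_exists_le hycov
  have hyk : dist (Ultralimit.mk yy) (c k) ≤ 2 * ε₀ := by
    rw [hc, Ultralimit.dist_mk]
    exact PreUltralimit.dist_le_of_eventually_le hk
  refine mem_iUnion₂.2 ⟨c k, mem_image_of_mem c (Finset.mem_coe.2 (Finset.mem_range.2
    (Nat.lt_succ_iff.2 hkN))), mem_ball.2 ?_⟩
  calc dist (Ultralimit.mk yy) (c k) ≤ 2 * ε₀ := hyk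
    _ < δ := by rw [hε₀]; linarith

/-- **The ultralimit of uniformly totally bounded pointed spaces is proper.**
[cite: HuangHuangWangZhu2026, §2.1 p. 6 Thm 2.1 (first assertion)] -/
theorem properSpace_ultralimit (hU : (U : Filter ℕ) ≤ atTop)
    (hcov : ∀ (R ε : ℝ), 0 < ε → ∃ N : ℕ, ∀ i, ∃ S : Finset (X i), S.card ≤ N ∧
      ∀ x ∈ closedBall (p i) R, ∃ s ∈ S, dist x s ≤ ε) :
    ProperSpace (Ultralimit p U) :=
  ProperSpace.of_seq_closedBall (x := Ultralimit.basePt p U) (r := fun n : ℕ ↦ (n : ℝ))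
    tendsto_natCast_atTop_atTop
    (Eventually.of_forall fun n ↦ isCompact_closedBall_ultralimit hU hcov (Nat.cast_nonneg n))

/-! ### §4. The theorem: a convergent subsequence -/

/-- **Gromov's precompactness theorem, pointed form** (the existence statement behind
Huang–Huang–Wang–Zhu 2026, Thm 2.1, first assertion, for pointed proper spaces): if the balls
`B̄(pᵢ, R)` of the pointed spaces `(Xᵢ, pᵢ)` are covered, for every `R` and `ε > 0`, by `ε`-balls
about at most `N(R, ε)` points, then for every ultrafilter `U` finer than `atTop` a subsequence
`(X_{φ n}, p_{φ n})` converges in the pointed Gromov–Hausdorff sense (`PointedGHConv`) to the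
ultralimit `(lim_U Xᵢ, basePt)`, a proper metric space (`properSpace_ultralimit`). (From
`eventually_exists_isPointedGHApprox` at `(R, ε) = (n, 1/(n+1))`, a diagonal subsequence, and the
monotonicity of approximations.) [cite: HuangHuangWangZhu2026, §2.1 p. 6 Thm 2.1 (first assertion)] -/
theorem exists_strictMono_pointedGHConv (hU : (U : Filter ℕ) ≤ atTop)
    (hcov : ∀ (R ε : ℝ), 0 < ε → ∃ N : ℕ, ∀ i, ∃ S : Finset (X i), S.card ≤ N ∧
      ∀ x ∈ closedBall (p i) R, ∃ s ∈ S, dist x s ≤ ε) :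
    ∃ φ : ℕ → ℕ, StrictMono φ ∧ PointedGHConv (fun n ↦ p (φ n)) (Ultralimit.basePt p U) := by
  set P : ℕ → ℕ → Prop := fun n i ↦ ∃ f : X i → Ultralimit p U,
    IsPointedGHApprox (n : ℝ) (1 / ((n : ℝ) + 1)) (p i) (Ultralimit.basePt p U) f with hP
  have hPn : ∀ n, ∀ᶠ i in (U : Filter ℕ), P n i := fun n ↦
    eventually_exists_isPointedGHApprox hcov (Nat.cast_nonneg n) (by positivity)
  have hQ : ∀ n, ∃ᶠ i in atTop, ∀ j ∈ Finset.range (n + 1), P j i := fun n ↦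
    frequently_atTop_of_eventually_ultrafilter hU
      ((Filter.eventually_all_finset _).2 fun j _ ↦ hPn j)
  obtain ⟨φ, hφ, hφP⟩ := extraction_forall_of_frequently hQ
  refine ⟨φ, hφ, fun R ε hε ↦ ?_⟩
  -- a level `n₀` with `R ≤ n₀` and `1/(n₀+1) ≤ ε`
  obtain ⟨n₀, hn₀⟩ : ∃ n₀ : ℕ, R ≤ n₀ ∧ 1 / ((n₀ : ℝ) + 1) ≤ ε := by
    obtain ⟨m, hm⟩ := exists_nat_ge (max R (1 / ε))
    refine ⟨m, (le_max_left _ _).trans hm, ?_⟩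
    have h1 : 1 / ε ≤ (m : ℝ) + 1 := ((le_max_right _ _).trans hm).trans (by linarith)
    rw [div_le_iff₀ (by positivity)]
    calc (1 : ℝ) = 1 / ε * ε := by field_simp
      _ ≤ ((m : ℝ) + 1) * ε := by gcongr
      _ = ε * ((m : ℝ) + 1) := by ring
  refine (eventually_ge_atTop n₀).mono fun m hm ↦ ?_
  obtain ⟨f, hf⟩ := hφP m n₀ (Finset.mem_range.2 (Nat.lt_succ_iff.2 hm))
  exact ⟨f, hf.mono hn₀.1 hn₀.2⟩

/-- The same with the hyperfilter as the default choice of `U`: **uniformly totally bounded pointed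
spaces have a pointed-Gromov–Hausdorff-convergent subsequence with proper limit.**
[cite: HuangHuangWangZhu2026, §2.1 p. 6 Thm 2.1 (first assertion)] -/
theorem exists_strictMono_pointedGHConv_hyperfilter
    (hcov : ∀ (R ε : ℝ), 0 < ε → ∃ N : ℕ, ∀ i, ∃ S : Finset (X i), S.card ≤ N ∧
      ∀ x ∈ closedBall (p i) R, ∃ s ∈ S, dist x s ≤ ε) :
    ProperSpace (Ultralimit p (hyperfilter ℕ)) ∧
      ∃ φ : ℕ → ℕ, StrictMono φ ∧
        PointedGHConv (fun n ↦ p (φ n)) (Ultralimit.basePt p (hyperfilter ℕ)) := by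
  have hU : ((hyperfilter ℕ : Ultrafilter ℕ) : Filter ℕ) ≤ atTop := by
    rw [← Nat.cofinite_eq_atTop]
    exact hyperfilter_le_cofinite
  exact ⟨properSpace_ultralimit hU hcov, exists_strictMono_pointedGHConv hU hcov⟩

end Limit

end Literature.Geometry.MetricGeometry
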